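import Literature.MathematicalPhysics.QuantumFieldTheory.Balaban1983to89.T4CouplingMatching
import Summits.QuantumFields.BalabanUV.Beta.RemainderExplicitHistoryDiagonalKernel

/-!
# RemainderExplicitHistoryDiagonalSum — ROAD P3: node U2's two-run recursion with a SCALE-SHIFT PROFILE `σ` in place of
# `cθ^k` and a MEMORY PROFILE `ρ(k − i)` in place of `Cθ^{k−i}`, summed over the CUTOFF along the diagonals of fixed
# infrared distance: for a family of infrared-pinned runs, `Σ_{n<N} disc(g^{(n+m)}, g^{(n+m+1)}, n) ≤ m·S∕(1 − Wγ∕b)` from `Σσ ≤ S`,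
# `Σρ ≤ W`, the floor `b ≤ β` and `Wγ < b` (station S-d4p3-g47-1 «existence without NE4 as typed»; the arithmetic is
# `RemainderExplicitHistoryDiagonalKernel.diag_sum_le`; `RemainderExplicitHistoryDiagonalExistence` reads the bound out as the continuum
# coupling scale by scale, `RemainderExplicitHistoryDiagonalProfile` applies it to road P3's order-0 profile family)

Cell `pub-balaban`, β-function sub-cell, BINDER row D4 «RemainderConst leaves for Bałaban's split» (`HOME/BINDER-OWNERS.md`; owner
lineage `b2b-balaban-beta-an4`; this file by co-owner #3 lineage `b2b-balaban-beta-d4-p3`, road P3 «the reduction road», generation 47,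
station S-d4p3-g47-1, second file; imports node U2 `T4CouplingMatching` and the station's kernel `RemainderExplicitHistoryDiagonalKernel`), β-FLOW TEAM duty (1); FREEZE (0) honoured (def-free
module in road P3's own `RemainderExplicit*` series; no leaf, no interface, no Literature file).  SOURCE OF THE SHAPES ONLY:
[Balaban1987RG1] (0.20) p. 256, (0.31) and Thm 2 p. 259, §1 p. 264, §5 p. 298.  Pure real analysis (finite sums).

HONEST FRAMING (page 1 of everything the β sub-cell writes).  *"Discharging BetaPertH makes Bałaban's UV stability UNCONDITIONAL —
a real constructive-QFT result; it is NOT the continuum limit and NOT the Clay problem."*  THIS FILE DISCHARGES NOTHING OF THE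
KIND.  It is the bookkeeping half of a located census distinction raised on road P3's order-0 profile families by the sibling
co-owner (journal [D4P2-G35-X20] INFO-1: those families meet node U2's NE4 AS TYPED, `ScaleShiftRate c θ γ β`, iff their profile is
GEOMETRIC, so neither node U2's `disc_le_of_fadingMemory` nor the sibling's renewal station (E33) covers the EXISTENCE of their
continuum coupling).  The answer typed by this station: existence of the continuum recursion variable at every fixed infrared
distance `m` needs NO geometric rate at all — a scale-shift PROFILE `|β_{k+2}(w) − β_{k+1}(Fin.tail w)| ≤ σ_k` with `Σσ < ∞`, history
moduli dominated by a memory PROFILE `Λ k i ≤ ρ(k − i)` with `Σρ < ∞`, the asymptotic-freedom floor `b ≤ β` and the smallness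
`(Σρ)·γ < b` make the two-run discrepancies SUMMABLE OVER THE CUTOFF along every diagonal, with a bound LINEAR in `m` (node U6's
summable-discrepancy currency).  What the geometric shapes (NE4 as typed, `FadingMemory`) buy is the K-UNIFORM RATE in the scale of
injection — node U2's `(2c∕(1−θ))θ^j`, (E33)'s stretched exponential — not existence.  Every hypothesis on `β` below is an UNPRINTED
SHAPE ([Balaban1987RG1] p. 264: "We will investigate other properties in a separate paper"; p. 298 names the dependence on the
preceding couplings, no modulus is printed; cell GAPS G-t4-U2-1, G-t4-U2-2), consumed as a binder; nothing of Bałaban's (1.22) is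
asserted or constructed; row D4 class UNCHANGED (critical-path width 0; instance 0∕1; D4 DISCHARGE NO DATE); NOT B12 Thm 2, NOT
BetaPertH, NOT continuum, NOT Clay.  HONEST DEPENDENCY: continuum YM on T⁴ ⇐ BetaPertH ∧ nine spine estimates (0/9 proved); BetaPertH
⇐ (D1) ∧ (D4) ∧ CAP+tail; G-an2-4 gates asym, D1 and NE2/3/4.  ABSOLUTE RULE: nothing is cited as a fact.

WHAT IS PROVED ([folklore]; 0 sorry; 0 `def`).
* §1 `disc_step_seq`: node U2's `disc_step` with the geometric `cθ^j` replaced by a PROFILE `σ_j` (binder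
  `∀ k w, w ∈ Box γ (k+1) → |β (k+1) w − β k (Fin.tail w)| ≤ σ k`; `scaleShift_seq_of_rate` ∕ `profiles_of_geometric`: NE4 as typed and
  `FadingMemory` are the geometric cases `σ_k = cθ^k`, `ρ_a = Cθ^a`, partial sums `≤ c∕(1−θ)`, `C∕(1−θ)`):
  `δ_j ≤ δ_{j+1} + σ_j + Σ_{i≤j} Λ j i·(g^A_i)²g^B_{i+1}·δ_i`; `disc_le_sum`: summed from the infrared pin (`backward_sum` BY NAME),
  `δ_j ≤ Σ_{l∈[j,K)} σ_l + Σ_{l∈[j,K)} Σ_{i≤l} Λ l i·(g^A_i)²g^B_{i+1}·δ_i`.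
* §2 `weight_le`: under the floor `BetaLowerH b γ β` the AF weight at infrared distance `n = K − i` is `(g^A_i)²g^B_{i+1} ≤ u_n :=
  1∕(a_n·√a_n)`, `a_n = 1∕γ² + b·n` (node U2's `prof` ∕ `sprof`), for BOTH pinned runs; `weight_nonneg`; `nat_mul_weight_le`: `n·u_n ≤ γ∕b`
  — the one number the diagonal summation needs (NOT the sum `Σu ≤ γ³ + 2γ∕b` of node U2's K-uniform argument).
* §3 `feedback_le_column`: with `Λ l i ≤ ρ(l − i)` the double sum regroups by COLUMNS,
  `Σ_{l∈[j,K)} Σ_{i≤l} Λ l i·w_i·δ_i ≤ Σ_{i<K} (Σ_{a∈[j∸i, K−i)} ρ_a)·w_i·δ_i` — the coupling `g_i` is felt by the scales `l ≥ max(i,j)`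
  through the WINDOW of ages `[j∸i, K−i)` of the profile.
* §4 END **`sum_disc_diag_le`**: a family of runs `K ↦ g K` of (0.20) with one history family `β` (`RGEqH K β (g K)`), couplings in
  ]0,γ], all pinned at the same renormalized coupling (`g K K = gIR`), scale-shift profile `σ` (`Σ_{l<n} σ_l ≤ S`), history moduli
  `0 ≤ Λ k i ≤ ρ(k − i)` (`Σ_{a<n} ρ_a ≤ W`), the floor `BetaLowerH b γ β` (`b > 0`) and the smallness `W·γ < b` has, at EVERY infrared
  distance `m` and for EVERY number of cutoffs `N`, `Σ_{n<N} disc (g (n+m)) (g (n+m+1)) n ≤ m·S∕(1 − Wγ∕b)` — §1–§3 fed into the kernel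
  `RemainderExplicitHistoryDiagonalKernel.diag_sum_le` with `u_n = 1∕(a_n√a_n)`, `κ = γ∕b`.  No geometric rate, no fading memory, no
  window renewal: the matching discrepancies are summable over the cutoff because the scale shift is, the memory is, and asymptotic
  freedom makes `n·g³` bounded at infrared distance `n`.
All letters NOT-IN-PRINT; `BetaFlowAsPrinted S` records a Markov β_n only ⇒ no junction of the as-printed interface changes.
-/

noncomputable section

open Finset

namespace Summit.QuantumFields.BalabanUV.Beta.RemainderExplicitHistoryDiagonalSum

open Literature.MathematicalPhysics.QuantumFieldTheory.Balaban1983to89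
open Literature.MathematicalPhysics.QuantumFieldTheory.Balaban1983to89.FlowStep
open Literature.MathematicalPhysics.QuantumFieldTheory.Balaban1983to89.T4CouplingMatching

/-! ## §1 Node U2's backward recursion with a scale-shift PROFILE `σ` -/

/-- NE4 AS TYPED is the geometric case of a scale-shift profile: `ScaleShiftRate c θ γ β` gives the binder shape of this file
with `σ_k = cθ^k`. [folklore] -/
theorem scaleShift_seq_of_rate {β : HBeta} {c θ γ : ℝ} (hS : ScaleShiftRate c θ γ β) :
    ∀ k (w : Fin (k + 2) → ℝ), w ∈ Box γ (k + 1) → |β (k + 1) w - β k (Fin.tail w)| ≤ (fun k => c * θ ^ k) k :=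
  hS

/-- NODE U2's GEOMETRIC BINDERS ARE THE GEOMETRIC CASE OF THIS FILE's PROFILES: `ScaleShiftRate c θ γ β` is the scale-shift profile
`σ_k = cθ^k` with partial sums `≤ c∕(1−θ)`, and `FadingMemory C θ Λ` is the memory profile `ρ_a = Cθ^a` (`0 ≤ Λ k i ≤ ρ(k−i)`) with partial
sums `≤ C∕(1−θ)` (`0 ≤ θ < 1`, `c, C ≥ 0`; `geom_sum_Ico_le_of_lt_one`).  So §4's END contains node U2's binder list (with the smallness
`Cγ < (1−θ)b` in place of `C(γ³ + 2γ∕b) ≤ (1−θ)∕2`) and gives existence — but no rate — there too. [folklore] -/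
theorem profiles_of_geometric {β : HBeta} {c C θ γ : ℝ} {Λ : ℕ → ℕ → ℝ} (hθ0 : 0 ≤ θ) (hθ1 : θ < 1) (hc : 0 ≤ c)
    (hC : 0 ≤ C) (hS : ScaleShiftRate c θ γ β) (hΛ : FadingMemory C θ Λ) :
    (∀ k (w : Fin (k + 2) → ℝ), w ∈ Box γ (k + 1) → |β (k + 1) w - β k (Fin.tail w)| ≤ (fun k => c * θ ^ k) k)
      ∧ (∀ n, ∑ l ∈ range n, (fun k => c * θ ^ k) l ≤ c / (1 - θ))
      ∧ (∀ k i, i ≤ k → 0 ≤ Λ k i) ∧ (∀ k i, i ≤ k → Λ k i ≤ (fun a => C * θ ^ a) (k - i))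
      ∧ (∀ n, ∑ a ∈ range n, (fun a => C * θ ^ a) a ≤ C / (1 - θ)) := by
  have hgeom : ∀ n, ∑ a ∈ range n, θ ^ a ≤ 1 / (1 - θ) := fun n => by
    have h := geom_sum_Ico_le_of_lt_one (m := 0) (n := n) hθ0 hθ1
    rwa [pow_zero, ← Finset.range_eq_Ico] at h
  refine ⟨hS, fun n => ?_, fun k i hi => (hΛ k i hi).1, fun k i hi => (hΛ k i hi).2, fun n => ?_⟩
  · calc ∑ l ∈ range n, c * θ ^ l = c * ∑ l ∈ range n, θ ^ l := by rw [Finset.mul_sum]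
      _ ≤ c * (1 / (1 - θ)) := mul_le_mul_of_nonneg_left (hgeom n) hc
      _ = c / (1 - θ) := by ring
  · calc ∑ a ∈ range n, C * θ ^ a = C * ∑ a ∈ range n, θ ^ a := by rw [Finset.mul_sum]
      _ ≤ C * (1 / (1 - θ)) := mul_le_mul_of_nonneg_left (hgeom n) hC
      _ = C / (1 - θ) := by ring

/-- **THE BACKWARD COUPLING-MATCHING RECURSION WITH A SCALE-SHIFT PROFILE** (node U2's `disc_step`, the geometric `cθ^j`
replaced by `σ_j`): two runs of (0.20) with the same history family `β` (A: `K` steps, B: `K + 1` steps, couplings in ]0,γ]),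
`|β_{k+2}(w) − β_{k+1}(Fin.tail w)| ≤ σ_k` on the boxes and `HistLipschitz Λ γ β` (`Λ ≥ 0`) give, for `j < K`,
`δ_j ≤ δ_{j+1} + σ_j + Σ_{i≤j} Λ j i·(g^A_i)²g^B_{i+1}·δ_i` (`δ = disc gA gB`).  Hypotheses, never facts. [cite: Balaban1987RG1, (0.20) p.256] -/
theorem disc_step_seq {β : HBeta} {γ : ℝ} {σ : ℕ → ℝ} {Λ : ℕ → ℕ → ℝ} {K : ℕ} {gA gB : ℕ → ℝ}
    (hA : RGEqH K β gA) (hB : RGEqH (K + 1) β gB)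
    (hAbox : ∀ i, i ≤ K → 0 < gA i ∧ gA i ≤ γ) (hBbox : ∀ i, i ≤ K + 1 → 0 < gB i ∧ gB i ≤ γ)
    (hS : ∀ k (w : Fin (k + 2) → ℝ), w ∈ Box γ (k + 1) → |β (k + 1) w - β k (Fin.tail w)| ≤ σ k)
    (hL : HistLipschitz Λ γ β) (hΛ : ∀ k i, i ≤ k → 0 ≤ Λ k i) {j : ℕ} (hj : j < K) :
    disc gA gB j ≤ disc gA gB (j + 1) + σ j
      + ∑ i ∈ range (j + 1), Λ j i * ((gA i) ^ 2 * gB (i + 1)) * disc gA gB i := by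
  have eA := hA j hj
  have eB := hB (j + 1) (by omega)
  have hwbox : prefixOf gB (j + 1) ∈ Box γ (j + 1) := prefixOf_mem_box (by omega) hBbox
  have hpA : prefixOf gA j ∈ Box γ j := prefixOf_mem_box hj.le hAbox
  have htail : Fin.tail (prefixOf gB (j + 1)) ∈ Box γ j := by
    rw [tail_prefixOf]
    exact prefixOf_mem_box (N := K) hj.le fun i hi => hBbox (i + 1) (by omega)
  have h1 := hS j (prefixOf gB (j + 1)) hwbox
  have h2 := hL j (Fin.tail (prefixOf gB (j + 1))) (prefixOf gA j) htail hpA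
  have h3 : ∑ i : Fin (j + 1), Λ j i * |Fin.tail (prefixOf gB (j + 1)) i - prefixOf gA j i|
      ≤ ∑ i ∈ range (j + 1), Λ j i * ((gA i) ^ 2 * gB (i + 1)) * disc gA gB i := by
    rw [Finset.sum_range (fun i => Λ j i * ((gA i) ^ 2 * gB (i + 1)) * disc gA gB i)]
    refine Finset.sum_le_sum fun i _ => ?_
    have hiK : (i : ℕ) ≤ K := by have := i.isLt; omega
    have hgA := hAbox i hiK
    have hgB := hBbox (i + 1) (by omega)
    simp only [Fin.tail, prefixOf_apply, Fin.val_succ]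
    rw [abs_sub_comm, mul_assoc]
    exact mul_le_mul_of_nonneg_left (abs_sub_le_of_inv_sq hgA.1 hgB.1)
      (hΛ j i (Nat.lt_succ_iff.mp i.isLt))
  have key : 1 / gA j ^ 2 - 1 / gB (j + 1) ^ 2
      = (1 / gA (j + 1) ^ 2 - 1 / gB (j + 1 + 1) ^ 2)
        + (β j (prefixOf gA j) - β j (Fin.tail (prefixOf gB (j + 1))))
        - (β (j + 1) (prefixOf gB (j + 1)) - β j (Fin.tail (prefixOf gB (j + 1)))) := by
    rw [eA, eB]
    ring
  have habs : disc gA gB j ≤ disc gA gB (j + 1)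
      + |β j (prefixOf gA j) - β j (Fin.tail (prefixOf gB (j + 1)))|
      + |β (j + 1) (prefixOf gB (j + 1)) - β j (Fin.tail (prefixOf gB (j + 1)))| := by
    simp only [disc]
    rw [key]
    exact (abs_sub _ _).trans (add_le_add (abs_add_le _ _) le_rfl)
  have hcomm : |β j (prefixOf gA j) - β j (Fin.tail (prefixOf gB (j + 1)))|
      = |β j (Fin.tail (prefixOf gB (j + 1))) - β j (prefixOf gA j)| := abs_sub_comm _ _
  linarith [habs, hcomm, h1, h2, h3]

/-- **SUMMED FROM THE INFRARED PIN** (node U2's `backward_sum` BY NAME): under the hypotheses of `disc_step_seq` and the pin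
`g^A_K = g^B_{K+1}`, for every `j ≤ K`,
`δ_j ≤ Σ_{l∈[j,K)} σ_l + Σ_{l∈[j,K)} Σ_{i≤l} Λ l i·(g^A_i)²g^B_{i+1}·δ_i`. [cite: Balaban1987RG1, (0.20) p.256 and Thm 2 p.259] -/
theorem disc_le_sum {β : HBeta} {γ : ℝ} {σ : ℕ → ℝ} {Λ : ℕ → ℕ → ℝ} {K : ℕ} {gA gB : ℕ → ℝ}
    (hA : RGEqH K β gA) (hB : RGEqH (K + 1) β gB)
    (hAbox : ∀ i, i ≤ K → 0 < gA i ∧ gA i ≤ γ) (hBbox : ∀ i, i ≤ K + 1 → 0 < gB i ∧ gB i ≤ γ)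
    (hpin : gA K = gB (K + 1))
    (hS : ∀ k (w : Fin (k + 2) → ℝ), w ∈ Box γ (k + 1) → |β (k + 1) w - β k (Fin.tail w)| ≤ σ k)
    (hL : HistLipschitz Λ γ β) (hΛ : ∀ k i, i ≤ k → 0 ≤ Λ k i) {j : ℕ} (hj : j ≤ K) :
    disc gA gB j ≤ (∑ l ∈ Ico j K, σ l)
      + ∑ l ∈ Ico j K, ∑ i ∈ range (l + 1), Λ l i * ((gA i) ^ 2 * gB (i + 1)) * disc gA gB i := by
  have h := backward_sum (δ := disc gA gB)
    (s := fun l => σ l + ∑ i ∈ range (l + 1), Λ l i * ((gA i) ^ 2 * gB (i + 1)) * disc gA gB i)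
    (le_of_eq (disc_pin hpin)) (fun l hl => by
      have := disc_step_seq hA hB hAbox hBbox hS hL hΛ hl
      linarith) j hj
  simpa [Finset.sum_add_distrib] using h

/-! ## §2 The AF weight at infrared distance `n`: `u_n = 1∕(a_n √a_n)`, and the one number `n·u_n ≤ γ∕b` -/

/-- **THE AF WEIGHT AT INFRARED DISTANCE `K − i`** (node U2 §4's pointwise comparison, both runs pinned at a coupling in ]0,γ]):
under `BetaLowerH b γ β` (`b > 0`, UNPRINTED input — [Balaban1989LargeFieldII] p. 355: the β-function paper "has not been published
yet"), `(g^A_i)² ≤ 1∕a_{K−i}` and `g^B_{i+1} ≤ 1∕√a_{K−i}` with `a_n = 1∕γ² + b·n` (`prof γ b n`, `sprof γ b n = √a_n`), hence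
`(g^A_i)²g^B_{i+1} ≤ 1∕(a_{K−i}·√a_{K−i})`. [cite: Balaban1987RG1, (0.31) p.259] -/
theorem weight_le {β : HBeta} {γ b : ℝ} {K : ℕ} {gA gB : ℕ → ℝ} (hγ : 0 < γ) (hb : 0 < b)
    (hA : RGEqH K β gA) (hB : RGEqH (K + 1) β gB)
    (hAbox : ∀ i, i ≤ K → 0 < gA i ∧ gA i ≤ γ) (hBbox : ∀ i, i ≤ K + 1 → 0 < gB i ∧ gB i ≤ γ)
    (hlo : BetaLowerH b γ β) {i : ℕ} (hi : i ≤ K) :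
    (gA i) ^ 2 * gB (i + 1) ≤ 1 / (prof γ b (K - i) * sprof γ b (K - i)) := by
  have hp0 := prof_pos hγ hb.le (K - i)
  have hs0 := sprof_pos hγ hb.le (K - i)
  have hgA := hAbox i hi
  have hgB := hBbox (i + 1) (by omega)
  have hgAK := hAbox K le_rfl
  have hgBK := hBbox (K + 1) le_rfl
  have hAK : 1 / γ ^ 2 ≤ 1 / (gA K) ^ 2 :=
    one_div_le_one_div_of_le (pow_pos hgAK.1 2) (pow_le_pow_left₀ hgAK.1.le hgAK.2 2)
  have hBK : 1 / γ ^ 2 ≤ 1 / (gB (K + 1)) ^ 2 :=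
    one_div_le_one_div_of_le (pow_pos hgBK.1 2) (pow_le_pow_left₀ hgBK.1.le hgBK.2 2)
  have h1 := inv_sq_lower_of_betaLower hA hAbox hlo hi
  have h2 := inv_sq_lower_of_betaLower hB hBbox hlo (i := i + 1) (by omega)
  have hKi : ((K + 1 - (i + 1) : ℕ) : ℝ) = ((K - i : ℕ) : ℝ) := by rw [Nat.add_sub_add_right]
  rw [hKi] at h2
  have haA : prof γ b (K - i) ≤ 1 / (gA i) ^ 2 := by unfold prof; linarith
  have haB : prof γ b (K - i) ≤ 1 / (gB (i + 1)) ^ 2 := by unfold prof; linarith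
  have hsqA : (gA i) ^ 2 ≤ 1 / prof γ b (K - i) := by
    rw [le_one_div (pow_pos hgA.1 2) hp0]
    exact haA
  have hsqB : (gB (i + 1)) ^ 2 ≤ (1 / sprof γ b (K - i)) ^ 2 := by
    rw [one_div_pow, sprof_sq hγ hb.le, le_one_div (pow_pos hgB.1 2) hp0]
    exact haB
  have hB' : gB (i + 1) ≤ 1 / sprof γ b (K - i) :=
    (pow_le_pow_iff_left₀ hgB.1.le (one_div_pos.mpr hs0).le two_ne_zero).mp hsqB
  calc (gA i) ^ 2 * gB (i + 1) ≤ (1 / prof γ b (K - i)) * (1 / sprof γ b (K - i)) :=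
        mul_le_mul hsqA hB' hgB.1.le (one_div_pos.mpr hp0).le
    _ = 1 / (prof γ b (K - i) * sprof γ b (K - i)) := by rw [one_div_mul_one_div]

/-- The weight is nonnegative. [folklore] -/
theorem weight_nonneg {γ b : ℝ} (hγ : 0 < γ) (hb : 0 ≤ b) (n : ℕ) : 0 ≤ 1 / (prof γ b n * sprof γ b n) :=
  (one_div_pos.mpr (mul_pos (prof_pos hγ hb n) (sprof_pos hγ hb n))).le

/-- **THE ONE NUMBER THE DIAGONAL SUMMATION NEEDS**: `n·u_n = n∕(a_n √a_n) ≤ γ∕b` for every `n` (`a_n ≥ b·n` and `√a_n ≥ 1∕γ`) —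
in place of node U2's K-uniform SUM `Σ_n u_n ≤ γ³ + 2γ∕b`. [folklore] -/
theorem nat_mul_weight_le {γ b : ℝ} (hγ : 0 < γ) (hb : 0 < b) (n : ℕ) :
    (n : ℝ) * (1 / (prof γ b n * sprof γ b n)) ≤ γ / b := by
  have hp0 := prof_pos hγ hb.le n
  have hs0 := sprof_pos hγ hb.le n
  have h1 : b * n ≤ prof γ b n := by
    unfold prof
    have : 0 ≤ 1 / γ ^ 2 := by positivity
    linarith
  have h2 : 1 / γ ≤ sprof γ b n := by
    rw [← sprof_zero (b := b) hγ]
    unfold sprof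
    exact Real.sqrt_le_sqrt (by unfold prof; simp; positivity)
  have h3 : b * n * (1 / γ) ≤ prof γ b n * sprof γ b n :=
    mul_le_mul h1 h2 (one_div_pos.mpr hγ).le hp0.le
  rw [mul_one_div, div_le_div_iff₀ (mul_pos hp0 hs0) hb]
  have e : b * n * (1 / γ) * γ = (n : ℝ) * b := by field_simp
  nlinarith [mul_le_mul_of_nonneg_right h3 hγ.le]

/-! ## §3 Regrouping the history feedback by columns under a memory PROFILE `Λ l i ≤ ρ(l − i)` -/

/-- **COLUMN FORM OF THE FEEDBACK.**  For nonnegative `w` (below `K`), `δ` and moduli `Λ l i ≤ ρ(l − i)` (`i ≤ l`):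
`Σ_{l∈[j,K)} Σ_{i≤l} Λ l i·w_i·δ_i ≤ Σ_{i<K} (Σ_{a∈[j∸i,K−i)} ρ_a)·w_i·δ_i` — swap the sums (`l ∈ [max(i,j), K)` for each `i < K`)
and shift `l = i + a`. [folklore] -/
theorem feedback_le_column {Λ : ℕ → ℕ → ℝ} {ρ w δ : ℕ → ℝ} {K j : ℕ}
    (hΛρ : ∀ l i, i ≤ l → Λ l i ≤ ρ (l - i)) (hw : ∀ i, i < K → 0 ≤ w i) (hδ : ∀ i, 0 ≤ δ i) :
    ∑ l ∈ Ico j K, ∑ i ∈ range (l + 1), Λ l i * w i * δ i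
      ≤ ∑ i ∈ range K, (∑ a ∈ Ico (j - i) (K - i), ρ a) * w i * δ i := by
  have hswap : ∑ l ∈ Ico j K, ∑ i ∈ range (l + 1), Λ l i * w i * δ i
      = ∑ i ∈ range K, ∑ l ∈ Ico (max i j) K, Λ l i * w i * δ i := by
    refine Finset.sum_comm' fun l i => ?_
    simp only [Finset.mem_Ico, Finset.mem_range, max_le_iff]
    omega
  rw [hswap]
  refine Finset.sum_le_sum fun i hi => ?_
  have hiK : i < K := Finset.mem_range.mp hi
  rw [← Finset.sum_mul, ← Finset.sum_mul]
  refine mul_le_mul_of_nonneg_right (mul_le_mul_of_nonneg_right ?_ (hw i hiK)) (hδ i)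
  have hshift : ∑ a ∈ Ico (j - i) (K - i), ρ a = ∑ l ∈ Ico (max i j) K, ρ (l - i) := by
    rw [← Finset.sum_Ico_add_right_sub_eq (f := ρ) (j - i) (K - i) i, show j - i + i = max i j by omega,
      show K - i + i = K by omega]
  rw [hshift]
  exact Finset.sum_le_sum fun l hl => hΛρ l i (by
    have := (Finset.mem_Ico.mp hl).1
    omega)

/-! ## §4 END: along every diagonal the two-run discrepancies are summable over the cutoff -/

/-- **ROAD P3 — THE MATCHING DISCREPANCIES ARE SUMMABLE OVER THE CUTOFF AT EVERY FIXED INFRARED DISTANCE, WITHOUT NE4 AS TYPED AND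
WITHOUT FADING MEMORY.**  A family of runs `K ↦ g K` of (0.20) with the same history family `β` (`RGEqH K β (g K)`), all couplings in
]0,γ], all pinned at the same renormalized coupling (`g K K = gIR` — Theorem 2's `g_K = g`, a hypothesis here); a scale-shift PROFILE
`|β_{k+2}(w) − β_{k+1}(Fin.tail w)| ≤ σ_k` with `Σ_{l<n} σ_l ≤ S`; history moduli `HistLipschitz Λ γ β` dominated by a memory PROFILE,
`0 ≤ Λ k i ≤ ρ(k − i)` with `Σ_{a<n} ρ_a ≤ W`; the floor `BetaLowerH b γ β`, `b > 0`; SMALLNESS `W·γ < b`.  THEN for every infrared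
distance `m` and every `N`: `Σ_{n<N} |1∕(g^{(n+m)}_n)² − 1∕(g^{(n+m+1)}_{n+1})²| ≤ m·S∕(1 − Wγ∕b)` — node U6's summable-discrepancy
currency, linear in `m`, uniform in `N`.  Node U2's geometric binders are the case `σ_k = cθ^k`, `ρ_a = Cθ^a` (then the K-uniform rate
`(2c∕(1−θ))θ^j` holds as well, `disc_le_of_fadingMemory`); here NO rate is produced and none is needed for existence
(`RemainderExplicitHistoryDiagonalExistence`).  Every hypothesis on `β` is an UNPRINTED shape; bookkeeping (§1–§3 +
`RemainderExplicitHistoryDiagonalKernel.diag_sum_le` with `u_n = 1∕(a_n√a_n)`, `κ = γ∕b`). [cite: Balaban1987RG1, (0.20) p.256 and Thm 2 p.259] -/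
theorem sum_disc_diag_le {β : HBeta} {γ b S W : ℝ} {σ ρ : ℕ → ℝ} {Λ : ℕ → ℕ → ℝ} (g : ℕ → ℕ → ℝ) (gIR : ℝ)
    (hγ : 0 < γ) (hb : 0 < b) (hσ0 : ∀ l, 0 ≤ σ l) (hρ0 : ∀ a, 0 ≤ ρ a)
    (hσS : ∀ n, ∑ l ∈ range n, σ l ≤ S) (hρW : ∀ n, ∑ a ∈ range n, ρ a ≤ W) (hsmall : W * γ < b)
    (hrun : ∀ K, RGEqH K β (g K)) (hbox : ∀ K i, i ≤ K → 0 < g K i ∧ g K i ≤ γ) (hpin : ∀ K, g K K = gIR)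
    (hS : ∀ k (w : Fin (k + 2) → ℝ), w ∈ Box γ (k + 1) → |β (k + 1) w - β k (Fin.tail w)| ≤ σ k)
    (hL : HistLipschitz Λ γ β) (hΛ0 : ∀ k i, i ≤ k → 0 ≤ Λ k i) (hΛρ : ∀ k i, i ≤ k → Λ k i ≤ ρ (k - i))
    (hlo : BetaLowerH b γ β) (m N : ℕ) :
    ∑ n ∈ range N, disc (g (n + m)) (g (n + m + 1)) n ≤ (m : ℝ) * S / (1 - W * γ / b) := by
  have hq : W * (γ / b) < 1 := by
    rw [← mul_div_assoc, div_lt_one hb]; exact hsmall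
  have hrec : ∀ K j, j ≤ K → disc (g K) (g (K + 1)) j ≤ (∑ l ∈ Ico j K, σ l)
      + ∑ i ∈ range K, (∑ a ∈ Ico (j - i) (K - i), ρ a) * (1 / (prof γ b (K - i) * sprof γ b (K - i)))
          * disc (g K) (g (K + 1)) i := by
    intro K j hj
    refine (disc_le_sum (hrun K) (hrun (K + 1)) (hbox K) (hbox (K + 1)) ((hpin K).trans (hpin (K + 1)).symm)
      hS hL hΛ0 hj).trans (add_le_add le_rfl ?_)
    refine (feedback_le_column (δ := fun i => disc (g K) (g (K + 1)) i) hΛρ (fun i hi => ?_)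
      (fun i => disc_nonneg _ _ _)).trans (Finset.sum_le_sum fun i hi => ?_)
    · have h1 := (hbox K i hi.le).1
      have h2 := (hbox (K + 1) (i + 1) (by omega)).1
      positivity
    · have hiK := Finset.mem_range.mp hi
      exact mul_le_mul_of_nonneg_right (mul_le_mul_of_nonneg_left
        (weight_le hγ hb (hrun K) (hrun (K + 1)) (hbox K) (hbox (K + 1)) hlo hiK.le)
        (Finset.sum_nonneg fun a _ => hρ0 a)) (disc_nonneg _ _ _)
  have h := RemainderExplicitHistoryDiagonalKernel.diag_sum_le (δ := fun K j => disc (g K) (g (K + 1)) j)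
    (fun K j => disc_nonneg _ _ _) hσ0 hρ0 (weight_nonneg hγ hb.le) hσS hρW (nat_mul_weight_le hγ hb) hq hrec m N
  rw [mul_div_assoc W γ b]
  exact h

end Summit.QuantumFields.BalabanUV.Beta.RemainderExplicitHistoryDiagonalSum

end
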